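import Summits.NavierStokesRegularity.NavierStokesRegularity.Theorems.ExtremiserTransienceNearExtremalTransienceExtremiserLiouvilleConstantSpeedCrossTerms
import HarnessLib

/-!
# Crux `ExtremiserTransience.NearExtremalTransience` (stmt-NavierStokesRegularity-21883), line `extremiser_liouville`,
# stub K1b — the CROSS TERMS of the far-field Caccioppoli inequality (2/2): palinstrophy cross term, pressure Hessian, assembly

`--supports stmt-NavierStokesRegularity-21883` (helper).  Author: prover seat `ns-el-k1b` (g7).  Continuation of
`…ConstantSpeedCrossTerms` (`V = v − c`, `ω = curl v`, `F = |Dω|²_F`):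

* `abs_integral_crossPalinstrophy_le` — `|C_×| ≤ (3/2)∫[‖Dθ‖(2F + ‖ω‖² + ‖Dv‖²) + ‖D∇θ‖(F + ‖V‖²)]`;
* `abs_integral_pressureHessian_le` — `|∫⟪ω, D∇p ω⟫| ≤ (η/2)(λZ + λ⁻¹W)` for `‖∇p‖ ≤ η`, every `λ > 0`
  (`∫⟪ω, D∇p ω⟫ = −∫⟪Dω ω, ∇p⟫`, divergence theorem in `L¹` form for `⟪ω,∇p⟫ω`);
* `farCaccioppoli_weighted` — the far-field Caccioppoli inequality of `…ConstantSpeedFarCaccioppoli` with all four bounds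
  inserted: for the constant-speed residue, `θ ∈ C^∞_c(ℝ³;[0,1])` supported where `‖v − c‖ ≤ σ`, `3σ ≤ κ⋆M`, and a smooth
  gradient corrector `∇p` (`‖∇p‖ ≤ η`):
  `½κ⋆²M²(W·Z_θ + Z·W_θ) ≤ 3|S|σ∫‖Dθ‖‖ω‖² + |S|σ∫‖Dθ‖(‖Dv‖² + 2‖ω‖²)
     + κ⋆²M²[(5/2)·W·∫‖D∇θ‖‖V‖² + (3/2)·Z·∫(‖Dθ‖(2F+‖ω‖²+‖Dv‖²) + ‖D∇θ‖(F+‖V‖²))] + (κ⋆ + κ⋆²)·M·Z·W·η`.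
  Every error term is an integral of `‖V‖², ‖ω‖², ‖Dv‖², F` against the WEIGHTS `‖Dθ‖, ‖D∇θ‖` — with `‖Dθ‖ ≲ R⁻¹`,
  `‖D∇θ‖ ≲ R⁻²` on a region of energy `≲ E₀R` the right-hand side is `O(1/R) + O(η)`, uniformly, with no hypothesis on `Dv`.

WHAT THIS IS NOT: K1b is NOT proved; nothing here proves NS regularity. [folklore]
-/

noncomputable section

open Set Filter Topology MeasureTheory Metric Function Real
open scoped ENNReal NNReal Topology InnerProductSpace RealInnerProductSpace ContDiff
open Literature.Analysis.FluidPDE Literature.Analysis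

namespace Summit.NavierStokesRegularity.NavierStokesRegularity.Theorems

-- the problem directory repeats the summit name (`NavierStokesRegularity/NavierStokesRegularity`)
set_option linter.dupNamespace false

namespace ExtremiserLiouville

open DepletionLadder.KStar DepletionLadder.KStar.HalfSpace

variable {v : E3 → E3} {c : E3} {θ : E3 → ℝ}

/-- `‖a × b‖ ≤ ‖a‖‖b‖` (private copy of the tree lemma). [folklore] -/
private theorem norm_cross_le'' (a b : E3) : ‖cross a b‖ ≤ ‖a‖ * ‖b‖ := norm_cross_le a b

/-! ## 3. The palinstrophy cross term `C_×` -/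

/-- **`|C_×| ≤ (3/2)∫[‖Dθ‖(2F + ‖ω‖² + ‖Dv‖²) + ‖D∇θ‖(F + ‖v − c‖²)]`**, `F = |Dω|²_F` (each `|∂ᵢω| ≤ ‖Dω‖ ≤ √F`,
three Young inequalities). [folklore] -/
theorem abs_integral_crossPalinstrophy_le (hv : ContDiff ℝ ∞ v) (hθ : ContDiff ℝ ∞ θ) (hθc : HasCompactSupport θ) :
    |∫ x, ∑ i, ⟪fderiv ℝ (curl v) x (EuclideanSpace.basisFun (Fin 3) ℝ i),
        (fderiv ℝ θ x (EuclideanSpace.basisFun (Fin 3) ℝ i)) • curl v x +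
          cross (fderiv ℝ (gradient θ) x (EuclideanSpace.basisFun (Fin 3) ℝ i)) (v x - c) +
          cross (gradient θ x) (fderiv ℝ v x (EuclideanSpace.basisFun (Fin 3) ℝ i))⟫| ≤
      (3 / 2 : ℝ) * ∫ x, (‖fderiv ℝ θ x‖ * (2 * frobeniusNormSq (fderiv ℝ (curl v) x) + ‖curl v x‖ ^ 2 + ‖fderiv ℝ v x‖ ^ 2) +
        ‖fderiv ℝ (gradient θ) x‖ * (frobeniusNormSq (fderiv ℝ (curl v) x) + ‖v x - c‖ ^ 2)) := by
  set b := EuclideanSpace.basisFun (Fin 3) ℝ with hbdef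
  have hb1 : ∀ i, ‖b i‖ = 1 := fun i => b.orthonormal.1 i
  have hω : ContDiff ℝ ∞ (curl v) := contDiff_curl_top hv
  have hω1 : ContDiff ℝ 1 (curl v) := hω.of_le (by norm_cast)
  have cω : Continuous (curl v) := hω.continuous
  have cDω : Continuous (fderiv ℝ (curl v)) := hω.continuous_fderiv (by simp)
  have cDv : Continuous (fderiv ℝ v) := hv.continuous_fderiv (by simp)
  have cV : Continuous (fun y => v y - c) := (hv.sub contDiff_const).continuous
  have cDθ : Continuous (fderiv ℝ θ) := hθ.continuous_fderiv (by simp)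
  have hg : ContDiff ℝ ∞ (gradient θ) := contDiff_gradient_top hθ
  have cDg : Continuous (fderiv ℝ (gradient θ)) := hg.continuous_fderiv (by simp)
  have hDθc : HasCompactSupport (fderiv ℝ θ) := hθc.fderiv (𝕜 := ℝ)
  have hDgc : HasCompactSupport (fderiv ℝ (gradient θ)) := (hasCompactSupport_gradient hθc).fderiv (𝕜 := ℝ)
  have cF : Continuous (fun x => frobeniusNormSq (fderiv ℝ (curl v) x)) := continuous_frobeniusNormSq_fderiv hω1 one_ne_zero
  have iw : Integrable (fun x => ‖fderiv ℝ θ x‖ * (2 * frobeniusNormSq (fderiv ℝ (curl v) x) + ‖curl v x‖ ^ 2 + ‖fderiv ℝ v x‖ ^ 2) +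
      ‖fderiv ℝ (gradient θ) x‖ * (frobeniusNormSq (fderiv ℝ (curl v) x) + ‖v x - c‖ ^ 2)) volume := by
    refine Integrable.add ?_ ?_
    · exact (cDθ.norm.mul (((continuous_const.mul cF).add (cω.norm.pow 2)).add (cDv.norm.pow 2))).integrable_of_hasCompactSupport
        hDθc.norm.mul_right
    · exact (cDg.norm.mul (cF.add (cV.norm.pow 2))).integrable_of_hasCompactSupport hDgc.norm.mul_right
  rw [← Real.norm_eq_abs, ← integral_const_mul]
  refine norm_integral_le_of_norm_le (iw.const_mul _) (Eventually.of_forall fun x => ?_)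
  set L := fderiv ℝ (curl v) x with hL
  set F := frobeniusNormSq L with hF
  set D := ‖fderiv ℝ θ x‖
  set D2 := ‖fderiv ℝ (gradient θ) x‖
  set A := ‖fderiv ℝ v x‖
  set O := ‖curl v x‖
  set U := ‖v x - c‖
  have hg' : ‖gradient θ x‖ = D := norm_gradient_eq_norm_fderiv θ x
  have hLF : ‖L‖ ^ 2 ≤ F := by
    have h := opNorm_le_sqrt_frobeniusNormSq L
    calc ‖L‖ ^ 2 ≤ (Real.sqrt F) ^ 2 := by gcongr
      _ = F := Real.sq_sqrt (frobeniusNormSq_nonneg _)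
  have hF0 : 0 ≤ F := frobeniusNormSq_nonneg _
  -- each summand
  have hterm : ∀ i, |⟪L (b i), (fderiv ℝ θ x (b i)) • curl v x + cross (fderiv ℝ (gradient θ) x (b i)) (v x - c) +
      cross (gradient θ x) (fderiv ℝ v x (b i))⟫| ≤ ‖L‖ * (D * O + D2 * U + D * A) := by
    intro i
    have hLi : ‖L (b i)‖ ≤ ‖L‖ := by
      calc ‖L (b i)‖ ≤ ‖L‖ * ‖b i‖ := L.le_opNorm _
        _ = ‖L‖ := by rw [hb1 i, mul_one]
    have ha1 : ‖(fderiv ℝ θ x (b i)) • curl v x‖ ≤ D * O := by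
      rw [norm_smul]
      refine mul_le_mul_of_nonneg_right ?_ (norm_nonneg _)
      calc ‖fderiv ℝ θ x (b i)‖ ≤ ‖fderiv ℝ θ x‖ * ‖b i‖ := (fderiv ℝ θ x).le_opNorm _
        _ = D := by rw [hb1 i, mul_one]
    have ha2 : ‖cross (fderiv ℝ (gradient θ) x (b i)) (v x - c)‖ ≤ D2 * U := by
      refine (norm_cross_le'' _ _).trans (mul_le_mul_of_nonneg_right ?_ (norm_nonneg _))
      calc ‖fderiv ℝ (gradient θ) x (b i)‖ ≤ ‖fderiv ℝ (gradient θ) x‖ * ‖b i‖ := (fderiv ℝ (gradient θ) x).le_opNorm _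
        _ = D2 := by rw [hb1 i, mul_one]
    have ha3 : ‖cross (gradient θ x) (fderiv ℝ v x (b i))‖ ≤ D * A := by
      refine (norm_cross_le'' _ _).trans ?_
      rw [hg']
      refine mul_le_mul_of_nonneg_left ?_ (norm_nonneg _)
      calc ‖fderiv ℝ v x (b i)‖ ≤ ‖fderiv ℝ v x‖ * ‖b i‖ := (fderiv ℝ v x).le_opNorm _
        _ = A := by rw [hb1 i, mul_one]
    have hsum : ‖(fderiv ℝ θ x (b i)) • curl v x + cross (fderiv ℝ (gradient θ) x (b i)) (v x - c) +
        cross (gradient θ x) (fderiv ℝ v x (b i))‖ ≤ D * O + D2 * U + D * A :=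
      (norm_add_le _ _).trans (add_le_add ((norm_add_le _ _).trans (add_le_add ha1 ha2)) ha3)
    calc _ ≤ ‖L (b i)‖ * ‖(fderiv ℝ θ x (b i)) • curl v x + cross (fderiv ℝ (gradient θ) x (b i)) (v x - c) +
          cross (gradient θ x) (fderiv ℝ v x (b i))‖ := abs_real_inner_le_norm _ _
      _ ≤ ‖L‖ * (D * O + D2 * U + D * A) := mul_le_mul hLi hsum (norm_nonneg _) (norm_nonneg _)
  have hS : |∑ i, ⟪L (b i), (fderiv ℝ θ x (b i)) • curl v x + cross (fderiv ℝ (gradient θ) x (b i)) (v x - c) +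
      cross (gradient θ x) (fderiv ℝ v x (b i))⟫| ≤ 3 * (‖L‖ * (D * O + D2 * U + D * A)) := by
    calc _ ≤ ∑ i, |⟪L (b i), (fderiv ℝ θ x (b i)) • curl v x + cross (fderiv ℝ (gradient θ) x (b i)) (v x - c) +
          cross (gradient θ x) (fderiv ℝ v x (b i))⟫| := Finset.abs_sum_le_sum_abs _ _
      _ ≤ ∑ _i : Fin 3, ‖L‖ * (D * O + D2 * U + D * A) := Finset.sum_le_sum fun i _ => hterm i
      _ = 3 * (‖L‖ * (D * O + D2 * U + D * A)) := by simp [Finset.sum_const, Finset.card_univ, Fintype.card_fin]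
  -- Young
  have hN0 : 0 ≤ ‖L‖ := norm_nonneg _
  have hy1 : ‖L‖ * O ≤ (F + O ^ 2) / 2 := by nlinarith [sq_nonneg (‖L‖ - O), hLF]
  have hy2 : ‖L‖ * U ≤ (F + U ^ 2) / 2 := by nlinarith [sq_nonneg (‖L‖ - U), hLF]
  have hy3 : ‖L‖ * A ≤ (F + A ^ 2) / 2 := by nlinarith [sq_nonneg (‖L‖ - A), hLF]
  have hD0 : 0 ≤ D := norm_nonneg _
  have hD20 : 0 ≤ D2 := norm_nonneg _
  rw [Real.norm_eq_abs]
  calc _ ≤ 3 * (‖L‖ * (D * O + D2 * U + D * A)) := hS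
    _ = 3 * (D * (‖L‖ * O) + D2 * (‖L‖ * U) + D * (‖L‖ * A)) := by ring
    _ ≤ 3 * (D * ((F + O ^ 2) / 2) + D2 * ((F + U ^ 2) / 2) + D * ((F + A ^ 2) / 2)) := by
        gcongr
    _ = 3 / 2 * (D * (2 * F + O ^ 2 + A ^ 2) + D2 * (F + U ^ 2)) := by ring

/-! ## 4. The pressure-Hessian term -/

/-- **`|∫⟪ω, D∇p ω⟫| ≤ (η/2)(λZ + λ⁻¹W)`** for every `λ > 0`, when `‖∇p‖ ≤ η`, `‖D∇p‖ ≤ B_p` (`v ∈ C^∞` with `ω, Dω ∈ L²`):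
`∫⟪ω, D∇p ω⟫ = −∫⟪Dω ω, ∇p⟫` by the `L¹` divergence theorem for the field `⟪ω, ∇p⟫ω`. [folklore] -/
theorem abs_integral_pressureHessian_le (hv : ContDiff ℝ ∞ v)
    (h1 : ∫⁻ x, ‖iteratedFDeriv ℝ 1 v x‖ₑ ^ 2 < ⊤) (h2 : ∫⁻ x, ‖iteratedFDeriv ℝ 2 v x‖ₑ ^ 2 < ⊤)
    {p : E3 → ℝ} (hp : ContDiff ℝ ∞ p) {η Bp : ℝ} (hpη : ∀ x, ‖gradient p x‖ ≤ η)
    (hpB : ∀ x, ‖fderiv ℝ (gradient p) x‖ ≤ Bp) {lam : ℝ} (hlam : 0 < lam) :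
    |∫ x, ⟪curl v x, fderiv ℝ (gradient p) x (curl v x)⟫| ≤
      η / 2 * (lam * (∫ x, ‖curl v x‖ ^ 2) + lam⁻¹ * ∫ x, frobeniusNormSq (fderiv ℝ (curl v) x)) := by
  have hη0 : 0 ≤ η := (norm_nonneg _).trans (hpη 0)
  have hω : ContDiff ℝ ∞ (curl v) := contDiff_curl_top hv
  have hω1 : ContDiff ℝ 1 (curl v) := hω.of_le (by norm_cast)
  have hωd : Differentiable ℝ (curl v) := hω1.differentiable one_ne_zero
  have cω : Continuous (curl v) := hω.continuous
  have cDω : Continuous (fderiv ℝ (curl v)) := hω.continuous_fderiv (by simp)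
  have hg : ContDiff ℝ ∞ (gradient p) := contDiff_gradient_top hp
  have hg1 : ContDiff ℝ 1 (gradient p) := hg.of_le (by norm_cast)
  have hgd : Differentiable ℝ (gradient p) := hg1.differentiable one_ne_zero
  have iZ : Integrable (fun x => ‖curl v x‖ ^ 2) volume := (integrable_norm_curl_sq (hv.of_le (by norm_cast)) h1).1
  have iW : Integrable (fun x => frobeniusNormSq (fderiv ℝ (curl v) x)) volume :=
    (integrable_frobeniusNormSq_fderiv_curl (hv.of_le (by norm_cast)) h2).1
  -- the field `X = ⟪ω, ∇p⟫ ω`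
  set g : E3 → ℝ := fun y => ⟪curl v y, gradient p y⟫ with hgdef
  have hg1' : ContDiff ℝ 1 g := hω1.inner ℝ hg1
  have hX1 : ContDiff ℝ 1 (fun y => g y • curl v y) := hg1'.smul hω1
  have hdivω : ∀ x, VectorCalculus.divergence (curl v) x = 0 := fun x =>
    divergence_curl_eq_zero_holds v (hv.of_le (by norm_cast)) x
  have hpt : ∀ x, VectorCalculus.divergence (fun y => g y • curl v y) x =
      ⟪curl v x, fderiv ℝ (gradient p) x (curl v x)⟫ + ⟪fderiv ℝ (curl v) x (curl v x), gradient p x⟫ := by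
    intro x
    rw [divergence_smul_apply (hg1'.differentiable one_ne_zero x) (hωd x), hdivω x, mul_zero, zero_add,
      real_inner_comm, gradient, InnerProductSpace.toDual_symm_apply]
    show fderiv ℝ (fun y => ⟪curl v y, gradient p y⟫) x (curl v x) = _
    rw [fderiv_inner_apply ℝ (hωd x) (hgd x)]
  -- pointwise majorants
  have hLF : ∀ x, ‖fderiv ℝ (curl v) x‖ ^ 2 ≤ frobeniusNormSq (fderiv ℝ (curl v) x) := fun x => by
    have h := opNorm_le_sqrt_frobeniusNormSq (fderiv ℝ (curl v) x)
    calc ‖fderiv ℝ (curl v) x‖ ^ 2 ≤ (Real.sqrt (frobeniusNormSq (fderiv ℝ (curl v) x))) ^ 2 := by gcongr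
      _ = _ := Real.sq_sqrt (frobeniusNormSq_nonneg _)
  have hm1 : ∀ x, ‖⟪fderiv ℝ (curl v) x (curl v x), gradient p x⟫‖ ≤
      η / 2 * (lam * ‖curl v x‖ ^ 2 + lam⁻¹ * frobeniusNormSq (fderiv ℝ (curl v) x)) := by
    intro x
    set L := fderiv ℝ (curl v) x
    set O := ‖curl v x‖
    have hyoung : ‖L‖ * O ≤ (lam * O ^ 2 + lam⁻¹ * ‖L‖ ^ 2) / 2 := by
      have hsq : 0 ≤ (lam * O - ‖L‖) ^ 2 := sq_nonneg _
      have hlam' : lam⁻¹ * ‖L‖ ^ 2 = ‖L‖ ^ 2 / lam := by rw [inv_mul_eq_div]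
      rw [hlam', le_div_iff₀ (by norm_num : (0:ℝ) < 2)]
      have key : 2 * lam * (‖L‖ * O) ≤ lam * (lam * O ^ 2) + ‖L‖ ^ 2 := by nlinarith [hsq]
      have h2 : lam * (lam * O ^ 2 + ‖L‖ ^ 2 / lam) = lam * (lam * O ^ 2) + ‖L‖ ^ 2 := by field_simp
      nlinarith [key, h2, hlam]
    rw [Real.norm_eq_abs]
    calc |⟪L (curl v x), gradient p x⟫| ≤ ‖L (curl v x)‖ * ‖gradient p x‖ := abs_real_inner_le_norm _ _
      _ ≤ (‖L‖ * O) * η := mul_le_mul (L.le_opNorm _) (hpη x) (norm_nonneg _) (by positivity)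
      _ ≤ ((lam * O ^ 2 + lam⁻¹ * ‖L‖ ^ 2) / 2) * η := mul_le_mul_of_nonneg_right hyoung hη0
      _ ≤ ((lam * O ^ 2 + lam⁻¹ * frobeniusNormSq L) / 2) * η := by
          have : lam⁻¹ * ‖L‖ ^ 2 ≤ lam⁻¹ * frobeniusNormSq L := mul_le_mul_of_nonneg_left (hLF x) (inv_nonneg.2 hlam.le)
          gcongr
      _ = η / 2 * (lam * O ^ 2 + lam⁻¹ * frobeniusNormSq L) := by ring
  have hm2 : ∀ x, ‖⟪curl v x, fderiv ℝ (gradient p) x (curl v x)⟫‖ ≤ Bp * ‖curl v x‖ ^ 2 := by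
    intro x
    rw [Real.norm_eq_abs]
    calc |⟪curl v x, fderiv ℝ (gradient p) x (curl v x)⟫| ≤ ‖curl v x‖ * ‖fderiv ℝ (gradient p) x (curl v x)‖ :=
          abs_real_inner_le_norm _ _
      _ ≤ ‖curl v x‖ * (‖fderiv ℝ (gradient p) x‖ * ‖curl v x‖) := by gcongr; exact (fderiv ℝ (gradient p) x).le_opNorm _
      _ ≤ ‖curl v x‖ * (Bp * ‖curl v x‖) := by gcongr; exact hpB x
      _ = Bp * ‖curl v x‖ ^ 2 := by ring
  -- integrability
  have i12 : Integrable (fun x => lam * ‖curl v x‖ ^ 2 + lam⁻¹ * frobeniusNormSq (fderiv ℝ (curl v) x)) volume :=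
    (iZ.const_mul lam).add (iW.const_mul lam⁻¹)
  have i1 : Integrable (fun x => ⟪fderiv ℝ (curl v) x (curl v x), gradient p x⟫) volume :=
    (i12.const_mul (η / 2)).mono' (((cDω.clm_apply cω).inner hg.continuous).aestronglyMeasurable) (Eventually.of_forall hm1)
  have i2 : Integrable (fun x => ⟪curl v x, fderiv ℝ (gradient p) x (curl v x)⟫) volume :=
    (iZ.const_mul Bp).mono' ((cω.inner ((hg.continuous_fderiv (by simp)).clm_apply cω)).aestronglyMeasurable)
      (Eventually.of_forall hm2)
  have iX : Integrable (fun y => g y • curl v y) volume := by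
    refine (iZ.const_mul η).mono' ((hg1'.continuous.smul cω).aestronglyMeasurable) (Eventually.of_forall fun x => ?_)
    rw [norm_smul, Real.norm_eq_abs]
    calc |g x| * ‖curl v x‖ ≤ (‖curl v x‖ * ‖gradient p x‖) * ‖curl v x‖ := by
          gcongr; exact abs_real_inner_le_norm _ _
      _ ≤ (‖curl v x‖ * η) * ‖curl v x‖ := by gcongr; exact hpη x
      _ = η * ‖curl v x‖ ^ 2 := by ring
  have idiv : Integrable (fun x => VectorCalculus.divergence (fun y => g y • curl v y) x) volume := by
    have e : (fun x => VectorCalculus.divergence (fun y => g y • curl v y) x) =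
        fun x => ⟪curl v x, fderiv ℝ (gradient p) x (curl v x)⟫ + ⟪fderiv ℝ (curl v) x (curl v x), gradient p x⟫ :=
      funext hpt
    rw [e]; exact i2.add i1
  have h0 := integral_divergence_eq_zero_of_integrable hX1 iX idiv
  simp_rw [hpt] at h0
  rw [integral_add i2 i1] at h0
  have hI : ‖∫ x, ⟪fderiv ℝ (curl v) x (curl v x), gradient p x⟫‖ ≤
      η / 2 * (lam * (∫ x, ‖curl v x‖ ^ 2) + lam⁻¹ * ∫ x, frobeniusNormSq (fderiv ℝ (curl v) x)) := by
    have h := norm_integral_le_of_norm_le (i12.const_mul (η / 2)) (Eventually.of_forall hm1)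
    rw [integral_const_mul, integral_add (iZ.const_mul lam) (iW.const_mul lam⁻¹), integral_const_mul,
      integral_const_mul] at h
    exact h
  rw [Real.norm_eq_abs] at hI
  have e : (∫ x, ⟪curl v x, fderiv ℝ (gradient p) x (curl v x)⟫) = -∫ x, ⟪fderiv ℝ (curl v) x (curl v x), gradient p x⟫ := by
    linarith
  rw [e, abs_neg]
  exact hI

/-! ## 5. The far-field Caccioppoli inequality with every error term bounded by cut-off weights -/

/-- **THE FAR-FIELD CACCIOPPOLI INEQUALITY, WEIGHTED FORM.**  For the constant-speed residue object (`‖v‖ ≡ M = ‖c‖`,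
`|S| = κ⋆M√Z√W`, `M√Z√W > 0`), every `θ ∈ C^∞_c(ℝ³;[0,1])` supported where `‖v − c‖ ≤ σ` with `3σ ≤ κ⋆M`, and every smooth
gradient corrector `∇p` of `(1−θ)(v−c)` with `‖∇p‖ ≤ η`:
`½κ⋆²M²(W·Z_θ + Z·W_θ) ≤ 3|S|σ∫‖Dθ‖‖ω‖² + |S|σ∫‖Dθ‖(‖Dv‖² + 2‖ω‖²)`
`  + κ⋆²M²·((5/2)·W·∫‖D∇θ‖‖V‖² + (3/2)·Z·∫(‖Dθ‖(2F + ‖ω‖² + ‖Dv‖²) + ‖D∇θ‖(F + ‖V‖²))) + (κ⋆ + κ⋆²)·M·Z·W·η`.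
[folklore] -/
theorem farCaccioppoli_weighted
    (hv : ContDiff ℝ ∞ v) (hdiv : VectorCalculus.IsDivFree v) {M B : ℝ} (hMpos : 0 < M)
    (hM : ∀ x, ‖v x‖ = M) (hcM : ‖c‖ = M) (hB : ∀ x, ‖fderiv ℝ v x‖ ≤ B)
    (h1 : ∫⁻ x, ‖iteratedFDeriv ℝ 1 v x‖ₑ ^ 2 < ⊤) (h2 : ∫⁻ x, ‖iteratedFDeriv ℝ 2 v x‖ₑ ^ 2 < ⊤)
    (hpos : 0 < M * Real.sqrt (Zen v) * Real.sqrt (Wpa v))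
    (hatt : |Jst v| = kStar * M * Real.sqrt (Zen v) * Real.sqrt (Wpa v))
    (hθ : ContDiff ℝ ∞ θ) (hθc : HasCompactSupport θ) (hθ01 : ∀ x, 0 ≤ θ x ∧ θ x ≤ 1)
    {σ : ℝ} (hσ0 : 0 ≤ σ) (hσ : ∀ x ∈ tsupport θ, ‖v x - c‖ ≤ σ) (hσK : 3 * σ ≤ kStar * M)
    {p : E3 → ℝ} (hp : ContDiff ℝ ∞ p) {η Bp : ℝ} (hpη : ∀ x, ‖gradient p x‖ ≤ η)
    (hpB : ∀ x, ‖fderiv ℝ (gradient p) x‖ ≤ Bp)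
    (hp1 : ∫⁻ x, ‖iteratedFDeriv ℝ 1 (gradient p) x‖ₑ ^ 2 < ⊤) (hp2 : ∫⁻ x, ‖iteratedFDeriv ℝ 2 (gradient p) x‖ₑ ^ 2 < ⊤)
    (hudiv : VectorCalculus.IsDivFree (fun x => (1 - θ x) • (v x - c) + gradient p x)) :
    kStar ^ 2 * M ^ 2 * (Wpa v * (∫ x, θ x * ‖curl v x‖ ^ 2) + Zen v * (∫ x, θ x * frobeniusNormSq (fderiv ℝ (curl v) x))) / 2 ≤
      3 * |Jst v| * σ * (∫ x, ‖fderiv ℝ θ x‖ * ‖curl v x‖ ^ 2) +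
        |Jst v| * σ * (∫ x, ‖fderiv ℝ θ x‖ * (‖fderiv ℝ v x‖ ^ 2 + 2 * ‖curl v x‖ ^ 2)) +
        kStar ^ 2 * M ^ 2 * ((5 / 2 : ℝ) * Wpa v * (∫ x, ‖fderiv ℝ (gradient θ) x‖ * ‖v x - c‖ ^ 2) +
          (3 / 2 : ℝ) * Zen v * ∫ x, (‖fderiv ℝ θ x‖ * (2 * frobeniusNormSq (fderiv ℝ (curl v) x) + ‖curl v x‖ ^ 2 + ‖fderiv ℝ v x‖ ^ 2) +
            ‖fderiv ℝ (gradient θ) x‖ * (frobeniusNormSq (fderiv ℝ (curl v) x) + ‖v x - c‖ ^ 2))) +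
        (kStar + kStar ^ 2) * M * Zen v * Wpa v * η := by
  have hmain := farCaccioppoli_of_gradient_corrector hv hdiv hMpos hM hcM hB h1 h2 hpos hatt hθ hθc hθ01 hσ0 hσ hσK hp
    hpη hpB hp1 hp2 hudiv
  have hJ := abs_integral_crossStretching_le (c := c) hv hθ hθc hσ0 hσ
  have hA := abs_integral_crossEnstrophy_le (c := c) hv hdiv hθ hθc
  have hC := abs_integral_crossPalinstrophy_le (c := c) hv hθ hθc
  -- positivity data
  have hZ0 : 0 ≤ Zen v := integral_nonneg fun x => sq_nonneg _
  have hW0 : 0 ≤ Wpa v := integral_nonneg fun x => frobeniusNormSq_nonneg _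
  set a : ℝ := Real.sqrt (Zen v) with hadef
  set b : ℝ := Real.sqrt (Wpa v) with hbdef
  have ha2 : a ^ 2 = Zen v := Real.sq_sqrt hZ0
  have hb2 : b ^ 2 = Wpa v := Real.sq_sqrt hW0
  have ha0 : 0 ≤ a := Real.sqrt_nonneg _
  have hb0 : 0 ≤ b := Real.sqrt_nonneg _
  have hab : 0 < a * b := by
    have : 0 < M * (a * b) := by rw [← mul_assoc]; exact hpos
    exact (pos_iff_pos_of_mul_pos this).1 hMpos
  have ha' : 0 < a := lt_of_le_of_ne ha0 (fun h => by rw [← h, zero_mul] at hab; exact lt_irrefl _ hab)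
  have hb' : 0 < b := lt_of_le_of_ne hb0 (fun h => by rw [← h, mul_zero] at hab; exact lt_irrefl _ hab)
  -- the pressure Hessian with `λ = b/a`
  have hPH := abs_integral_pressureHessian_le hv h1 h2 hp hpη hpB (div_pos hb' ha')
  change |∫ x, ⟪curl v x, fderiv ℝ (gradient p) x (curl v x)⟫| ≤ η / 2 * (b / a * Zen v + (b / a)⁻¹ * Wpa v) at hPH
  -- abbreviations (values forgotten)
  set S : ℝ := Jst v with hSdef
  set Z : ℝ := Zen v
  set W : ℝ := Wpa v
  set Zθ : ℝ := ∫ x, θ x * ‖curl v x‖ ^ 2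
  set Wθ : ℝ := ∫ x, θ x * frobeniusNormSq (fderiv ℝ (curl v) x)
  set Dθ : ℝ := ∫ x, ‖fderiv ℝ θ x‖ * ‖curl v x‖ ^ 2
  set Jx : ℝ := ∫ x, (⟪cross (gradient θ x) (v x - c), fderiv ℝ v x (curl v x)⟫ +
      (fderiv ℝ θ x (curl v x)) * ⟪curl v x, v x - c⟫ + ⟪curl v x, fderiv ℝ v x (cross (gradient θ x) (v x - c))⟫)
  set Ax : ℝ := ∫ x, ⟪curl v x, cross (gradient θ x) (v x - c)⟫
  set Cx : ℝ := ∫ x, ∑ i, ⟪fderiv ℝ (curl v) x (EuclideanSpace.basisFun (Fin 3) ℝ i),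
      (fderiv ℝ θ x (EuclideanSpace.basisFun (Fin 3) ℝ i)) • curl v x +
        cross (fderiv ℝ (gradient θ) x (EuclideanSpace.basisFun (Fin 3) ℝ i)) (v x - c) +
        cross (gradient θ x) (fderiv ℝ v x (EuclideanSpace.basisFun (Fin 3) ℝ i))⟫
  set PH : ℝ := ∫ x, ⟪curl v x, fderiv ℝ (gradient p) x (curl v x)⟫
  set Jw : ℝ := ∫ x, ‖fderiv ℝ θ x‖ * (‖fderiv ℝ v x‖ ^ 2 + 2 * ‖curl v x‖ ^ 2)
  set Aw : ℝ := ∫ x, ‖fderiv ℝ (gradient θ) x‖ * ‖v x - c‖ ^ 2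
  set Cw : ℝ := ∫ x, (‖fderiv ℝ θ x‖ * (2 * frobeniusNormSq (fderiv ℝ (curl v) x) + ‖curl v x‖ ^ 2 + ‖fderiv ℝ v x‖ ^ 2) +
      ‖fderiv ℝ (gradient θ) x‖ * (frobeniusNormSq (fderiv ℝ (curl v) x) + ‖v x - c‖ ^ 2))
  clear_value S Z W Zθ Wθ Dθ Jx Ax Cx PH Jw Aw Cw a b
  -- the `η`-term: `|S|(η/2)((b/a)Z + (a/b)W) = κ⋆ M Z W η`
  have hη0 : 0 ≤ η := (norm_nonneg _).trans (hpη 0)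
  have hkey : |S| * (η / 2 * (b / a * Z + (b / a)⁻¹ * W)) = kStar * M * Z * W * η := by
    rw [hatt, ← ha2, ← hb2]
    field_simp
    ring
  have hS0 : 0 ≤ |S| := abs_nonneg _
  have e1 : |S| * |PH| ≤ kStar * M * Z * W * η := by
    rw [← hkey]; exact mul_le_mul_of_nonneg_left hPH hS0
  have e2 : |S| * |Jx| ≤ |S| * (σ * Jw) := mul_le_mul_of_nonneg_left hJ hS0
  have hK2 : 0 ≤ kStar ^ 2 * M ^ 2 := by positivity
  have e3 : kStar ^ 2 * M ^ 2 * (W * |Ax| + Z * |Cx|) ≤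
      kStar ^ 2 * M ^ 2 * (W * ((5 / 2 : ℝ) * Aw) + Z * ((3 / 2 : ℝ) * Cw)) := by
    refine mul_le_mul_of_nonneg_left ?_ hK2
    exact add_le_add (mul_le_mul_of_nonneg_left hA hW0) (mul_le_mul_of_nonneg_left hC hZ0)
  have e4 : kStar ^ 2 * M ^ 2 * (W * ((5 / 2 : ℝ) * Aw) + Z * ((3 / 2 : ℝ) * Cw)) =
      kStar ^ 2 * M ^ 2 * ((5 / 2 : ℝ) * W * Aw + (3 / 2 : ℝ) * Z * Cw) := by ring
  have e5 : (kStar + kStar ^ 2) * M * Z * W * η = kStar * M * Z * W * η + kStar ^ 2 * M * Z * W * η := by ring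
  linarith [hmain, e1, e2, e3, e4, e5]

end ExtremiserLiouville

end Summit.NavierStokesRegularity.NavierStokesRegularity.Theorems

end
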